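import Mathlib
import HarnessLib
import Summits.ResolutionOfSingularities.ResolutionOfSingularities.Theorems.WildQuotientsWildQuotientResolutionCotangentRep
import Summits.ResolutionOfSingularities.ResolutionOfSingularities.Theorems.WildQuotientsWildQuotientResolutionCommonEigenvector

/-!
# An abelian stabiliser has an eigen-parameter and a stable tangent hyperplane (the Kollár–Szabó eigenline, local form)
# (crux `WildQuotients.WildQuotientResolution`, stub `stub_phaseZeroHighDim`; any dimension, tame or wild)

Crux stmt-ResolutionOfSingularities-15640 (`WildQuotientResolution`), registered stub `stub_phaseZeroHighDim`.
The negative side-lemma ✓`StandardForm.not_primeOrbitSeparation_of_commuting_conjugates` (p824255) rests on the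
named fact `KollarSzaboGoingDown` (Reichstein–Youssin 2000, App., Prop. A.2), whose proof is: an abelian group `H`
fixing a regular point `x` has an eigenLINE in `T_x X`, i.e. a fixed point on the exceptional divisor `ℙ(𝔪/𝔪²)`
of the blow-up of `x`, then induction on the dimension. This file is the LOCAL-RING form of that first step, in the
vocabulary of ✓`CotangentRep.exists_cotangentRep` (p820344's companion; the `κ`-linear cotangent representation of a
residue-trivial action) and of the engine ✓`CommonEigenvector` (common eigen(co)vectors of commutative monoids):

for a residue-trivial action `τ` of an ABELIAN group `I` on a Noetherian local ring `(A, 𝔪, κ)` which is not a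
field, with `κ` algebraically closed (closed points over `k = k̄`) —

* `exists_eigenParameter` — an EIGEN-PARAMETER: `x ∈ 𝔪 ∖ 𝔪²` with `τ g x ≡ u_g · x (mod 𝔪²)` for every `g ∈ I`;
* `exists_stable_tangentHyperplane` — a STABLE TANGENT HYPERPLANE: an ideal `𝔪² ≤ W < 𝔪`, of codimension one in
  `𝔪` (`W + (t) = 𝔪` for every `t ∈ 𝔪 ∖ W`), with `τ g (W) ⊆ W` for every `g`; and for every `t ∈ 𝔪 ∖ W` the
  congruence `τ g t ≡ u · t (mod W)` holds with `u` a UNIT (`exists_unit_mul_sub_mem_of_not_mem`) — in the blow-up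
  chart `D₊(t)` of `Bl_𝔪`, the ideal `𝔪·S + (W/t)·S` is the `I`-fixed closed point of the exceptional divisor that
  the going-down argument follows.

No tameness is assumed (`I` may be a `p`-group): commuting automorphisms of `𝔪/𝔪²` over `κ = κ̄` share an
eigenvector. [OURS · crux stmt-ResolutionOfSingularities-15640 · helper toward `stub_phaseZeroHighDim` (local form
of the Kollár–Szabó eigenline; NOT a proof of the stub); folklore local algebra, counted 0; AI-level work, weaker than
expert review.] [folklore]
-/

-- single-problem summit: the doubled namespace component `ResolutionOfSingularities` is forced
set_option linter.dupNamespace false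

namespace Summit.ResolutionOfSingularities.ResolutionOfSingularities.Theorems.WildQuotientResolution.AbelianEigenline

open IsLocalRing Module
open Summit.ResolutionOfSingularities.ResolutionOfSingularities.Theorems.WildQuotientResolution

variable {A : Type*} [CommRing A] [IsLocalRing A] [IsNoetherianRing A]
variable {I : Type*} [CommGroup I] (τ : I →* (A ≃+* A)) (hres : ∀ (g : I) (a : A), τ g a - a ∈ maximalIdeal A)

/-- The cotangent space of a Noetherian local ring which is not a field is non-zero. [folklore] -/
theorem nontrivial_cotangentSpace (hA : ¬ IsField A) : Nontrivial (CotangentSpace A) := by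
  rw [← not_subsingleton_iff_nontrivial, subsingleton_cotangentSpace_iff]
  exact hA

omit [IsNoetherianRing A] in
/-- Scalars of `A` act on the cotangent space through their residues. [folklore] -/
theorem residue_smul_toCotangent (b : A) (x : maximalIdeal A) :
    (residue A b) • (maximalIdeal A).toCotangent x = (maximalIdeal A).toCotangent (b • x) := by
  rw [LinearMap.map_smul]
  exact IsScalarTower.algebraMap_smul (ResidueField A) b _

include hres

/-- **Eigen-parameter of an abelian stabiliser.** For a residue-trivial action of an abelian group `I` on a
Noetherian local ring `(A, 𝔪, κ)`, not a field, with `κ` algebraically closed, some `x ∈ 𝔪 ∖ 𝔪²` is a common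
eigenvector modulo `𝔪²`: `τ g x − u_g x ∈ 𝔪²` for all `g`. [folklore] -/
theorem exists_eigenParameter [IsAlgClosed (ResidueField A)] (hA : ¬ IsField A) :
    ∃ x : A, x ∈ maximalIdeal A ∧ x ∉ maximalIdeal A ^ 2 ∧
      ∀ g : I, ∃ u : A, τ g x - u * x ∈ maximalIdeal A ^ 2 := by
  haveI := nontrivial_cotangentSpace (A := A) hA
  obtain ⟨φ, hφ⟩ := CotangentRep.exists_cotangentRep τ hres
  obtain ⟨v, hv, hev⟩ := CommonEigenvector.exists_common_eigenvector_linearEquiv φ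
  obtain ⟨x, rfl⟩ := (maximalIdeal A).toCotangent_surjective v
  refine ⟨(x : A), x.2, fun hx2 => hv ((Ideal.toCotangent_eq_zero _ x).mpr hx2), fun g => ?_⟩
  obtain ⟨μ, hμ⟩ := hev g
  obtain ⟨u, rfl⟩ := Ideal.Quotient.mk_surjective μ
  refine ⟨u, ?_⟩
  have h1 : (maximalIdeal A).toCotangent ⟨τ g x, CotangentRep.maximalIdeal_le_comap (τ g) (hres g) x.2⟩ =
      (maximalIdeal A).toCotangent (u • x) := by
    rw [← hφ g x, hμ]
    exact residue_smul_toCotangent u x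
  have h2 := (Ideal.toCotangent_eq (maximalIdeal A)).mp h1
  simpa [SetLike.val_smul, smul_eq_mul] using h2

/-- **Stable tangent hyperplane of an abelian stabiliser** (the Kollár–Szabó eigenline, local form). For a
residue-trivial action of an abelian group `I` on a Noetherian local ring `(A, 𝔪, κ)`, not a field, with `κ`
algebraically closed, there is an ideal `W` with `𝔪² ≤ W ≤ 𝔪`, `W ≠ 𝔪`, `W + (t) = 𝔪` for every `t ∈ 𝔪 ∖ W`
(a hyperplane of `𝔪/𝔪²`), and `τ g (W) ⊆ W` for every `g ∈ I`. [folklore] -/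
theorem exists_stable_tangentHyperplane [IsAlgClosed (ResidueField A)] (hA : ¬ IsField A) :
    ∃ W : Ideal A, maximalIdeal A ^ 2 ≤ W ∧ W ≤ maximalIdeal A ∧ W ≠ maximalIdeal A ∧
      (∀ t ∈ maximalIdeal A, t ∉ W → W ⊔ Ideal.span {t} = maximalIdeal A) ∧
      ∀ g : I, ∀ w ∈ W, τ g w ∈ W := by
  haveI := nontrivial_cotangentSpace (A := A) hA
  obtain ⟨φ, hφ⟩ := CotangentRep.exists_cotangentRep τ hres
  obtain ⟨l, hl, hel⟩ := CommonEigenvector.exists_common_eigencovector_linearEquiv φ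
  -- `W` = the preimage in `𝔪` of the hyperplane `ker λ ⊆ 𝔪/𝔪²`
  let Wm : Submodule A (maximalIdeal A) :=
    ((LinearMap.ker l).restrictScalars A).comap (maximalIdeal A).toCotangent
  let W : Ideal A := Wm.map (maximalIdeal A).subtype
  have memW : ∀ a : A, a ∈ W ↔ ∃ h : a ∈ maximalIdeal A, l ((maximalIdeal A).toCotangent ⟨a, h⟩) = 0 := by
    intro a
    constructor
    · rintro ⟨y, hy, rfl⟩
      exact ⟨y.2, by simpa [Wm] using hy⟩
    · rintro ⟨h, hl0⟩
      exact ⟨⟨a, h⟩, by simpa [Wm] using hl0, rfl⟩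
  have hWle : W ≤ maximalIdeal A := fun a ha => by
    obtain ⟨h, -⟩ := (memW a).mp ha
    exact h
  refine ⟨W, ?_, hWle, ?_, ?_, ?_⟩
  · -- `𝔪² ≤ W`
    intro a ha
    have ham : a ∈ maximalIdeal A := Ideal.pow_le_self two_ne_zero ha
    refine (memW a).mpr ⟨ham, ?_⟩
    rw [(Ideal.toCotangent_eq_zero (maximalIdeal A) ⟨a, ham⟩).mpr ha, map_zero]
  · -- `W ≠ 𝔪`: `λ ≠ 0`
    intro hWeq
    apply hl
    apply LinearMap.ext
    intro v
    obtain ⟨x, rfl⟩ := (maximalIdeal A).toCotangent_surjective v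
    have hxW : (x : A) ∈ W := by rw [hWeq]; exact x.2
    obtain ⟨h, h0⟩ := (memW x).mp hxW
    simpa using h0
  · -- hyperplane: `W + (t) = 𝔪` for `t ∈ 𝔪 ∖ W`
    intro t ht htW
    have hlt : l ((maximalIdeal A).toCotangent ⟨t, ht⟩) ≠ 0 := fun h0 => htW ((memW t).mpr ⟨ht, h0⟩)
    apply le_antisymm (sup_le hWle ((Ideal.span_singleton_le_iff_mem _).mpr ht))
    intro a ha
    -- `a - b t ∈ W` for a lift `b` of `λ[a] / λ[t]`
    obtain ⟨b, hb⟩ := IsLocalRing.residue_surjective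
      (l ((maximalIdeal A).toCotangent ⟨a, ha⟩) / l ((maximalIdeal A).toCotangent ⟨t, ht⟩))
    have habt : a - b * t ∈ maximalIdeal A :=
      sub_mem ha (Ideal.mul_mem_left _ b ht)
    have hW' : a - b * t ∈ W := by
      refine (memW _).mpr ⟨habt, ?_⟩
      have e : (⟨a - b * t, habt⟩ : maximalIdeal A) = ⟨a, ha⟩ - b • ⟨t, ht⟩ := by
        apply Subtype.ext
        simp
      rw [e, map_sub, ← residue_smul_toCotangent, map_sub, LinearMap.map_smul, smul_eq_mul, hb,
        div_mul_cancel₀ _ hlt, sub_self]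
    have e : a = (a - b * t) + b * t := by ring
    rw [e]
    exact Submodule.add_mem_sup hW' (Ideal.mul_mem_left _ b (Ideal.mem_span_singleton_self t))
  · -- stability under `I`
    intro g w hw
    obtain ⟨hwm, hw0⟩ := (memW w).mp hw
    have hgw : τ g w ∈ maximalIdeal A := CotangentRep.maximalIdeal_le_comap (τ g) (hres g) hwm
    refine (memW _).mpr ⟨hgw, ?_⟩
    obtain ⟨μ, hμ⟩ := hel g
    have h1 := hφ g ⟨w, hwm⟩
    have h2 := congrArg (fun f => f ((maximalIdeal A).toCotangent ⟨w, hwm⟩)) hμ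
    simp only [LinearMap.coe_comp, Function.comp_apply, LinearEquiv.coe_coe, LinearMap.smul_apply,
      smul_eq_mul] at h2
    rw [h1] at h2
    rw [h2, hw0, mul_zero]

omit [IsNoetherianRing A] in
/-- **The eigenvalue along a transversal parameter is a unit.** In the situation of
`exists_stable_tangentHyperplane`, for ANY ideal `W` with `𝔪² ≤ W`, `W + (t) = 𝔪` (`t ∈ 𝔪 ∖ W`) and
`τ g (W) ⊆ W` for all `g`: `τ g t ≡ u · t (mod W)` with `u` a unit — the action on the LINE `𝔪/W` is by a
non-zero scalar. (In the blow-up chart `D₊(t)` this makes `τ g t / t` a unit at the fixed point.) [folklore] -/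
theorem exists_unit_mul_sub_mem_of_not_mem (W : Ideal A) (hW2 : maximalIdeal A ^ 2 ≤ W)
    (hstab : ∀ g : I, ∀ w ∈ W, τ g w ∈ W)
    {t : A} (ht : t ∈ maximalIdeal A) (htW : t ∉ W) (hsup : W ⊔ Ideal.span {t} = maximalIdeal A) (g : I) :
    ∃ u : A, IsUnit u ∧ τ g t - u * t ∈ W := by
  -- `τ g t ∈ 𝔪 = W + (t)`: `τ g t = w + u t`
  have hgt : τ g t ∈ maximalIdeal A := CotangentRep.maximalIdeal_le_comap (τ g) (hres g) ht
  rw [← hsup] at hgt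
  obtain ⟨w, hw, c, hc, hwc⟩ := Submodule.mem_sup.mp hgt
  obtain ⟨u, rfl⟩ := Ideal.mem_span_singleton'.mp hc
  refine ⟨u, ?_, by rw [← hwc]; simpa using hw⟩
  -- if `u ∈ 𝔪` then `τ g t ∈ W + 𝔪 t ⊆ W`-ish: precisely `u t ∈ 𝔪² ≤ W`, so `τ g t ∈ W`, and applying
  -- `τ g⁻¹` (which also stabilises `W`) gives `t ∈ W`, a contradiction
  by_contra hu
  have hum : u ∈ maximalIdeal A := (IsLocalRing.mem_maximalIdeal u).mpr (mem_nonunits_iff.mpr hu)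
  have hut : u * t ∈ W := hW2 (by rw [pow_two]; exact Ideal.mul_mem_mul hum ht)
  have hgtW : τ g t ∈ W := by rw [← hwc]; exact add_mem hw hut
  have : t ∈ W := by
    have h := hstab g⁻¹ _ hgtW
    rwa [← RingAut.mul_apply, ← map_mul, inv_mul_cancel, map_one, RingAut.one_apply] at h
  exact htW this

end Summit.ResolutionOfSingularities.ResolutionOfSingularities.Theorems.WildQuotientResolution.AbelianEigenline
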